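/-
Copyright (c) 2026 the pub-hodgecm-mathlib formalisation cell (harness21).  Prover seat hodgecm-mathlib-K2E5-p10 (g4), Track B «K2-LIT» ∕ h413
(`stmt-HodgeConjecture-24833`), line `K2_E3_EllipticInputs`, unit U12, §L road «U-iso-T» brick (G⁺-b)/(K1): THE TWISTED LINE-WEIGHT PAIRING ON `𝔤𝔩₂(F)` —
`∫_K χ(k) ∫_{F⁴} ω(y₀) g(k [[y₁,y₂],[y₀,y₃]] k⁻¹) = c ∫ g(X) · (∫_K χ(k) ω((k⁻¹Xk)₁₀) dκ) dμ𝔤(X)` (Tonelli + `Ad(K)`-invariance of `μ𝔤`).  2026-09-04.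
-/
import Summits.HodgeConjecture.HodgeConjecture.Theorems.K2E3GL2RegularNilpotentFourierLineInversion  -- ★ p856988 (K2E5-p17 (g3)): the chart, `isAddHaarMeasure_map_chart`; ★ p856815 `lintegral_comp_conj_of_mem_glInt`
import HarnessLib

/-!
# K2_E3 road (h413), §L brick (G⁺-b)/(K1) — the twisted line-weight pairing on `𝔤𝔩₂(F)`

Cell `pub/hodgecm-mathlib` (D-0151), Track B, seat K2E5-p10 (g4) (free E5 hand on the E3 §L line; §L lead K2E3-p12 (g4), dealer K2E3-plan (g3); (G⁺-b)
«(L-B_GL)^{Nm} ⟸ structure + reg(ν̂_{𝒪±})», cut of 2026-09-04T04:23Z: line side K2E5-p17 (g3), `K`-side this seat).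
`--supports stmt-HodgeConjecture-24833 --as helper`; THEOREMS ONLY (no definition ∕ instance ∕ notation ∕ named fact ∕ `sorry`); never imports
`Cruxes/…/Lines`.  COUNT-NEUTRAL.

For the `G⁺`-orbital measures `ν_{𝒪±}` of the two halves of the regular nilpotent orbit of `𝔤𝔩₂(F)` (`G⁺ = {det ∈ Nm(Eˣ)}`), the line side writes the
unstable combination `(ν̂₊ − ν̂₋)(f)` as `∫_K η(det k) · Z(G_k) dκ` with `G_k(s) = ∫_{F³} f(k [[r₀,r₁],[s,r₂]] k⁻¹) dr` and `Z` a (regularised) line functional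
`G ↦ ∫ ω(s) G(s) ds`.  The `K`-side starts here with the convention-free TONELLI STEP: for every measurable `χ ≥ 0` on `K = GL₂(𝒪)`, `ω ≥ 0` on `F` and
`g ≥ 0` on `𝔤𝔩₂(F)` (`κ` s-finite on `K`, `dx`, `μ𝔤` additive Haar measures), with ONE constant `c ∈ (0,∞)` (the Haar ratio `chart_* dx^{⊗4} ∕ μ𝔤`),
  `∫⁻_K χ(k) ∫⁻_{F⁴} ω(y₀) g(k [[y₁,y₂],[y₀,y₃]] k⁻¹) dx^{⊗4}(y) dκ(k) = c · ∫⁻ g(X) · (∫⁻_K χ(k) ω((k⁻¹ X k)₁₀) dκ(k)) dμ𝔤(X)`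
(**`lintegral_twistedLineWeight_pairing`**): the chart (★ p856988) and Haar uniqueness turn `dx^{⊗4}` into `c·μ𝔤`, `Ad(k)`-invariance of `μ𝔤` (★ p856815
`lintegral_comp_conj_of_mem_glInt`) moves `k` from the test function to the weight, and Tonelli exchanges `K` and `𝔤𝔩₂(F)`.  The `K`-average
`A_{χ,ω}(X) = ∫⁻_K χ(k) ω((k⁻¹Xk)₁₀) dκ` is the object the later (G⁺-b) bricks evaluate over the Bruhat cells (`(n⁻(−σ)Xn⁻(σ))₁₀` is a quadratic in `σ` of
discriminant `disc χ_X`).  Also: §1 `lintegral_chart_eq_smul` (the chart constant as a standalone lemma) and §3 `conj_entry_one_zero` (`(k⁻¹Xk)₁₀` in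
coordinates).
[HarishChandra1999AdmissibleDistributions, §3, Thm. 4.4, §7] [LabesseLanglands1979, §2 (the unstable regular nilpotent combination on `SL₂`)]
HONEST LABEL: HC_CM is proved only modulo the 7 printed citations (2 remaining named inputs: hLiu418 = stmt-HodgeConjecture-24832, h413 =
stmt-HodgeConjecture-24833) until rung 0 closes; count-neutral helper toward (LBU-2⁺)∕(G⁺-b), NOT ★.

## References
* [HarishChandra1999AdmissibleDistributions] Harish-Chandra (DeBacker–Sally), *Admissible Invariant Distributions on Reductive p-adic Groups* (1999), §3, §7.
* [LabesseLanglands1979] J.-P. Labesse, R. P. Langlands, *L-indistinguishability for SL(2)*, Canad. J. Math. 31 (1979), §2.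
-/

set_option autoImplicit false
set_option linter.dupNamespace false   -- `Summit.HodgeConjecture.HodgeConjecture.…` (D-0017 nested layout; lakefile exemption for Summits)

noncomputable section

open MeasureTheory Measure Filter Topology Set
open scoped MatrixGroups NNReal ENNReal Pointwise
open ValuativeRel
open Literature.NumberTheory.Automorphic Literature.NumberTheory.Automorphic.LocalFieldHaar
open Literature.NumberTheory.GaloisRepresentations Literature.NumberTheory.GaloisRepresentations.IsNonarchimedeanLocalField
open Summit.HodgeConjecture.HodgeConjecture.Cruxes.H413.K2E3GL2RegularNilpotentFourierLineInversion
open Summit.HodgeConjecture.HodgeConjecture.Cruxes.H413.K2E3GLnLieAdIntegralInvariant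

namespace Summit.HodgeConjecture.HodgeConjecture.Cruxes.H413.K2E3GL2TwistedLineWeightPairing

variable {F : Type*} [Field F] [ValuativeRel F] [TopologicalSpace F] [IsNonarchimedeanLocalField F]

/-! ## §1  The chart constant: `∫⁻ G ∘ chart d(dx^{⊗4}) = c · ∫⁻ G dμ𝔤` -/

section Chart
variable [MeasurableSpace F] [BorelSpace F] (dx : Measure F) [dx.IsAddHaarMeasure]
  [MeasurableSpace (Matrix (Fin 2) (Fin 2) F)] [BorelSpace (Matrix (Fin 2) (Fin 2) F)] (μ𝔤 : Measure (Matrix (Fin 2) (Fin 2) F)) [μ𝔤.IsAddHaarMeasure]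

/-- **The chart constant**: there is ONE `c ∈ (0, ∞)` (`c = (μ𝔤 ∕ chart_* dx^{⊗4})⁻¹`, Haar uniqueness) with `∫⁻ G [[y₁,y₂],[y₀,y₃]] dx^{⊗4}(y) = c ∫⁻ G dμ𝔤` for every
measurable `G ≥ 0`. [cite: WeilBNT1967, Ch. I §2] -/
theorem lintegral_chart_eq_smul :
    ∃ c : ℝ≥0∞, c ≠ 0 ∧ c ≠ ⊤ ∧ ∀ G : Matrix (Fin 2) (Fin 2) F → ℝ≥0∞, Measurable G →
      ∫⁻ y : Fin 4 → F, G !![y 1, y 2; y 0, y 3] ∂(Measure.pi fun _ : Fin 4 => dx) = c * ∫⁻ X, G X ∂μ𝔤 := by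
  haveI : T2Space F := (isLocalField F).toT2Space
  haveI : LocallyCompactSpace F := (isLocalField F).toLocallyCompactSpace
  haveI : SecondCountableTopology F := secondCountableTopology_localField F
  haveI : LocallyCompactSpace (Matrix (Fin 2) (Fin 2) F) := Pi.locallyCompactSpace_of_finite
  haveI : SecondCountableTopology (Matrix (Fin 2) (Fin 2) F) := inferInstanceAs (SecondCountableTopology (Fin 2 → Fin 2 → F))
  set ν : Measure (Matrix (Fin 2) (Fin 2) F) :=
    Measure.map (fun x : Fin 4 → F => (!![x 1, x 2; x 0, x 3] : Matrix (Fin 2) (Fin 2) F)) (Measure.pi fun _ : Fin 4 => dx) with hν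
  haveI : ν.IsAddHaarMeasure := isAddHaarMeasure_map_chart dx
  have huniq : μ𝔤 = μ𝔤.addHaarScalarFactor ν • ν := isAddLeftInvariant_eq_smul μ𝔤 ν
  set a : ℝ≥0 := μ𝔤.addHaarScalarFactor ν with ha
  have hapos : 0 < a := addHaarScalarFactor_pos_of_isAddHaarMeasure μ𝔤 ν
  refine ⟨((a⁻¹ : ℝ≥0) : ℝ≥0∞), by exact_mod_cast (inv_pos.2 hapos).ne', ENNReal.coe_ne_top, fun G hG => ?_⟩
  rw [← lintegral_map hG continuous_chart.measurable, ← hν]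
  conv_rhs => rw [huniq]
  rw [lintegral_smul_measure, ENNReal.smul_def, smul_eq_mul, ← mul_assoc, ← ENNReal.coe_mul, inv_mul_cancel₀ hapos.ne',
    ENNReal.coe_one, one_mul]

end Chart

/-! ## §2  `(k⁻¹ X k)₁₀` and the twisted line-weight pairing -/

omit [ValuativeRel F] [TopologicalSpace F] [IsNonarchimedeanLocalField F] in
/-- `Ad(k⁻¹)` then `Ad(k)` is the identity on `𝔤𝔩₂(F)`. [folklore] -/
theorem conj_conj_inv (k : GL (Fin 2) F) (X : Matrix (Fin 2) (Fin 2) F) :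
    (k : Matrix (Fin 2) (Fin 2) F) * (((k⁻¹ : GL (Fin 2) F) : Matrix (Fin 2) (Fin 2) F) * X * (k : Matrix (Fin 2) (Fin 2) F)) *
        ((k⁻¹ : GL (Fin 2) F) : Matrix (Fin 2) (Fin 2) F) = X := by
  have hkk : ((k⁻¹ : GL (Fin 2) F) : Matrix (Fin 2) (Fin 2) F) * (k : Matrix (Fin 2) (Fin 2) F) = 1 := by
    rw [← Units.val_mul, inv_mul_cancel, Units.val_one]
  have hkk' : (k : Matrix (Fin 2) (Fin 2) F) * ((k⁻¹ : GL (Fin 2) F) : Matrix (Fin 2) (Fin 2) F) = 1 := by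
    rw [← Units.val_mul, mul_inv_cancel, Units.val_one]
  simp only [← Matrix.mul_assoc]
  rw [hkk', Matrix.one_mul, Matrix.mul_assoc, hkk', Matrix.mul_one]

/-- The chart reads its `0`-th coordinate as the `(1,0)` entry. [folklore] -/
theorem chart_apply_one_zero {R : Type*} (y : Fin 4 → R) : ((!![y 1, y 2; y 0, y 3] : Matrix (Fin 2) (Fin 2) R)) 1 0 = y 0 := by
  simp

section Pairing
variable [MeasurableSpace F] [BorelSpace F] (dx : Measure F) [dx.IsAddHaarMeasure]
  [MeasurableSpace (GL (Fin 2) F)] [BorelSpace (GL (Fin 2) F)]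
  [MeasurableSpace (Matrix (Fin 2) (Fin 2) F)] [BorelSpace (Matrix (Fin 2) (Fin 2) F)] (μ𝔤 : Measure (Matrix (Fin 2) (Fin 2) F)) [μ𝔤.IsAddHaarMeasure]

/-- **THE TWISTED LINE-WEIGHT PAIRING (Tonelli step of (G⁺-b)).**  There is ONE constant `c ∈ (0,∞)` (the chart constant of §1) such that for every
s-finite measure `κ` on `K = GL₂(𝒪)` and all measurable `χ ≥ 0` on `K`, `ω ≥ 0` on `F`, `g ≥ 0` on `𝔤𝔩₂(F)`:
`∫⁻_K χ(k) ∫⁻_{F⁴} ω(y₀) g(k [[y₁,y₂],[y₀,y₃]] k⁻¹) dx^{⊗4} dκ = c · ∫⁻ g(X) · (∫⁻_K χ(k) ω((k⁻¹ X k)₁₀) dκ) dμ𝔤` — the pairing of `g` with the `K`-AVERAGE of the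
line weight `ω` read in the `(1,0)` entry of `Ad(k⁻¹)X`, twisted by `χ`.  (With `χ = η∘det`, `ω = η·‖·‖⁻¹` (truncated) this is the `K`-side of the unstable
regular nilpotent combination `ν̂₊ − ν̂₋`; with `χ = 1`, `ω = 1_{𝔭ⁿ}∕dx(𝔭ⁿ)` and `n → ∞` it degenerates to the Borel slice of ★ (b-ii).)
[cite: HarishChandra1999AdmissibleDistributions, §3 p. 8, Thm. 4.4] [cite: LabesseLanglands1979, §2] -/
theorem lintegral_twistedLineWeight_pairing :
    ∃ c : ℝ≥0∞, c ≠ 0 ∧ c ≠ ⊤ ∧ ∀ (κ : Measure ↥(glInt 2 F)) [SFinite κ] (χ : ↥(glInt 2 F) → ℝ≥0∞), Measurable χ →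
      ∀ ω : F → ℝ≥0∞, Measurable ω → ∀ g : Matrix (Fin 2) (Fin 2) F → ℝ≥0∞, Measurable g →
        ∫⁻ k, χ k * ∫⁻ y : Fin 4 → F, ω (y 0) * g (((k : GL (Fin 2) F) : Matrix (Fin 2) (Fin 2) F) * !![y 1, y 2; y 0, y 3] *
            ((((k : GL (Fin 2) F))⁻¹ : GL (Fin 2) F) : Matrix (Fin 2) (Fin 2) F)) ∂(Measure.pi fun _ : Fin 4 => dx) ∂κ =
          c * ∫⁻ X, g X * ∫⁻ k, χ k * ω ((((((k : GL (Fin 2) F))⁻¹ : GL (Fin 2) F) : Matrix (Fin 2) (Fin 2) F) * X *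
            ((k : GL (Fin 2) F) : Matrix (Fin 2) (Fin 2) F)) 1 0) ∂κ ∂μ𝔤 := by
  haveI : T2Space F := (isLocalField F).toT2Space
  haveI : LocallyCompactSpace F := (isLocalField F).toLocallyCompactSpace
  haveI : SecondCountableTopology F := secondCountableTopology_localField F
  haveI : SecondCountableTopology (Matrix (Fin 2) (Fin 2) F) := inferInstanceAs (SecondCountableTopology (Fin 2 → Fin 2 → F))
  haveI : LocallyCompactSpace (Matrix (Fin 2) (Fin 2) F) := Pi.locallyCompactSpace_of_finite
  haveI : BorelSpace ↥(glInt 2 F) := Subtype.borelSpace _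
  obtain ⟨c, hc0, hct, hchart⟩ := lintegral_chart_eq_smul dx μ𝔤
  refine ⟨c, hc0, hct, fun κ _ χ hχ ω hω g hg => ?_⟩
  -- the weight read in coordinates: `W(k, X) = ω((k⁻¹ X k)₁₀)`, jointly measurable
  have hconj : Continuous fun p : ↥(glInt 2 F) × Matrix (Fin 2) (Fin 2) F =>
      ((((p.1 : GL (Fin 2) F))⁻¹ : GL (Fin 2) F) : Matrix (Fin 2) (Fin 2) F) * p.2 * ((p.1 : GL (Fin 2) F) : Matrix (Fin 2) (Fin 2) F) :=
    ((Units.continuous_coe_inv.comp (continuous_subtype_val.comp continuous_fst)).mul continuous_snd).mul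
      (Units.continuous_val.comp (continuous_subtype_val.comp continuous_fst))
  have hWm : Measurable fun p : ↥(glInt 2 F) × Matrix (Fin 2) (Fin 2) F =>
      χ p.1 * ω ((((((p.1 : GL (Fin 2) F))⁻¹ : GL (Fin 2) F) : Matrix (Fin 2) (Fin 2) F) * p.2 * ((p.1 : GL (Fin 2) F) : Matrix (Fin 2) (Fin 2) F)) 1 0) :=
    Measurable.fun_mul (hχ.comp measurable_fst) (hω.comp ((continuous_id.matrix_elem 1 0).measurable.comp hconj.measurable))
  -- STEP 1: for each `k`, chart + `Ad(k)`-invariance of `μ𝔤`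
  have hstep : ∀ k : ↥(glInt 2 F),
      ∫⁻ y : Fin 4 → F, ω (y 0) * g (((k : GL (Fin 2) F) : Matrix (Fin 2) (Fin 2) F) * !![y 1, y 2; y 0, y 3] *
          ((((k : GL (Fin 2) F))⁻¹ : GL (Fin 2) F) : Matrix (Fin 2) (Fin 2) F)) ∂(Measure.pi fun _ : Fin 4 => dx) =
        c * ∫⁻ X, ω ((((((k : GL (Fin 2) F))⁻¹ : GL (Fin 2) F) : Matrix (Fin 2) (Fin 2) F) * X * ((k : GL (Fin 2) F) : Matrix (Fin 2) (Fin 2) F)) 1 0) *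
          g X ∂μ𝔤 := by
    intro k
    have hGm : Measurable fun Y : Matrix (Fin 2) (Fin 2) F =>
        ω (Y 1 0) * g (((k : GL (Fin 2) F) : Matrix (Fin 2) (Fin 2) F) * Y * ((((k : GL (Fin 2) F))⁻¹ : GL (Fin 2) F) : Matrix (Fin 2) (Fin 2) F)) :=
      Measurable.fun_mul (hω.comp (continuous_id.matrix_elem 1 0).measurable) (hg.comp (continuous_conj (k : GL (Fin 2) F)).measurable)
    have h1 := hchart _ hGm
    simp only [chart_apply_one_zero] at h1
    rw [h1]
    congr 1
    -- `Ad(k)`-substitution: `Y = k⁻¹ X k`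
    rw [← lintegral_comp_conj_of_mem_glInt μ𝔤 (k⁻¹).2 (fun Y => ω (Y 1 0) *
      g (((k : GL (Fin 2) F) : Matrix (Fin 2) (Fin 2) F) * Y * ((((k : GL (Fin 2) F))⁻¹ : GL (Fin 2) F) : Matrix (Fin 2) (Fin 2) F)))]
    refine lintegral_congr fun X => ?_
    simp only [Subgroup.coe_inv, inv_inv, conj_conj_inv]
  -- STEP 2: Tonelli
  have hmeas2 : Measurable fun p : ↥(glInt 2 F) × Matrix (Fin 2) (Fin 2) F =>
      χ p.1 * (c * (ω ((((((p.1 : GL (Fin 2) F))⁻¹ : GL (Fin 2) F) : Matrix (Fin 2) (Fin 2) F) * p.2 * ((p.1 : GL (Fin 2) F) : Matrix (Fin 2) (Fin 2) F)) 1 0) *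
        g p.2)) := by
    refine Measurable.fun_mul (hχ.comp measurable_fst) (Measurable.const_mul (Measurable.fun_mul ?_ (hg.comp measurable_snd)) c)
    exact hω.comp ((continuous_id.matrix_elem 1 0).measurable.comp hconj.measurable)
  simp_rw [hstep]
  -- measurability of the weight in each variable (lambda form)
  have h10 : Measurable fun Y : Matrix (Fin 2) (Fin 2) F => Y 1 0 := (continuous_id.matrix_elem 1 0).measurable
  have hWk : ∀ k : ↥(glInt 2 F), Measurable fun X : Matrix (Fin 2) (Fin 2) F =>
      ω ((((((k : GL (Fin 2) F))⁻¹ : GL (Fin 2) F) : Matrix (Fin 2) (Fin 2) F) * X * ((k : GL (Fin 2) F) : Matrix (Fin 2) (Fin 2) F)) 1 0) * g X := by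
    intro k
    have hc : Continuous fun X : Matrix (Fin 2) (Fin 2) F =>
        (((((k : GL (Fin 2) F))⁻¹ : GL (Fin 2) F) : Matrix (Fin 2) (Fin 2) F) * X * ((k : GL (Fin 2) F) : Matrix (Fin 2) (Fin 2) F)) :=
      (continuous_const.mul continuous_id).mul continuous_const
    exact Measurable.fun_mul (hω.comp (h10.comp hc.measurable)) hg
  have hWX : ∀ X : Matrix (Fin 2) (Fin 2) F, Measurable fun k : ↥(glInt 2 F) =>
      χ k * ω ((((((k : GL (Fin 2) F))⁻¹ : GL (Fin 2) F) : Matrix (Fin 2) (Fin 2) F) * X * ((k : GL (Fin 2) F) : Matrix (Fin 2) (Fin 2) F)) 1 0) := by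
    intro X
    have hck : Continuous fun k : ↥(glInt 2 F) =>
        (((((k : GL (Fin 2) F))⁻¹ : GL (Fin 2) F) : Matrix (Fin 2) (Fin 2) F) * X * ((k : GL (Fin 2) F) : Matrix (Fin 2) (Fin 2) F)) := by
      refine Continuous.mul (Continuous.mul ?_ continuous_const) ?_
      · exact Units.continuous_coe_inv.comp continuous_subtype_val
      · exact Units.continuous_val.comp continuous_subtype_val
    exact Measurable.fun_mul hχ (hω.comp (h10.comp hck.measurable))
  calc ∫⁻ k, χ k * (c * ∫⁻ X, ω ((((((k : GL (Fin 2) F))⁻¹ : GL (Fin 2) F) : Matrix (Fin 2) (Fin 2) F) * X *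
            ((k : GL (Fin 2) F) : Matrix (Fin 2) (Fin 2) F)) 1 0) * g X ∂μ𝔤) ∂κ
      = ∫⁻ k, ∫⁻ X, χ k * (c * (ω ((((((k : GL (Fin 2) F))⁻¹ : GL (Fin 2) F) : Matrix (Fin 2) (Fin 2) F) * X *
            ((k : GL (Fin 2) F) : Matrix (Fin 2) (Fin 2) F)) 1 0) * g X)) ∂μ𝔤 ∂κ := by
          refine lintegral_congr fun k => ?_
          rw [← lintegral_const_mul c (hWk k), ← lintegral_const_mul (χ k) ((hWk k).const_mul c)]
    _ = ∫⁻ X, ∫⁻ k, χ k * (c * (ω ((((((k : GL (Fin 2) F))⁻¹ : GL (Fin 2) F) : Matrix (Fin 2) (Fin 2) F) * X *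
            ((k : GL (Fin 2) F) : Matrix (Fin 2) (Fin 2) F)) 1 0) * g X)) ∂κ ∂μ𝔤 := lintegral_lintegral_swap hmeas2.aemeasurable
    _ = c * ∫⁻ X, g X * ∫⁻ k, χ k * ω ((((((k : GL (Fin 2) F))⁻¹ : GL (Fin 2) F) : Matrix (Fin 2) (Fin 2) F) * X *
            ((k : GL (Fin 2) F) : Matrix (Fin 2) (Fin 2) F)) 1 0) ∂κ ∂μ𝔤 := by
          rw [← lintegral_const_mul c (Measurable.fun_mul hg hWm.lintegral_prod_left')]
          refine lintegral_congr fun X => ?_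
          rw [← lintegral_const_mul (g X) (hWX X), ← lintegral_const_mul c ((hWX X).const_mul (g X))]
          refine lintegral_congr fun k => ?_
          ring

end Pairing

end Summit.HodgeConjecture.HodgeConjecture.Cruxes.H413.K2E3GL2TwistedLineWeightPairing

end
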